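import Mathlib
import Literature.Analysis.FluidPDE.Tao2016AveragedNS.RenormalisedCascadeWaves
import Literature.Analysis.FluidPDE.Tao2016AveragedNS.SelfSimilarCascadeBlowup
import Literature.Analysis.FluidPDE.Tao2016AveragedNS.ViscousEternalSolutions
import Literature.Analysis.FluidPDE.Tao2016AveragedNS.BoundedEternalSolutions
import Summits.NavierStokesRegularity.NavierStokesRegularity.Theses.TaoLadderRungTwoBreak
import Summits.NavierStokesRegularity.NavierStokesRegularity.Theorems.WakeRatchetTailRatchet.Negative.TailRatchetFalseOfDyadicScalarFronts
import Summits.NavierStokesRegularity.NavierStokesRegularity.Theorems.WakeRatchetTailRatchetScalarFrontNoSlow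
import HarnessLib

/-!
# Crux `TaoLadderRungTwoBreak.NoSurvivingEternalViscBddOne` (stmt-NavierStokesRegularity-20419), split child (ρ0)
# `stub_noSurvivingEternalBddOne`, and ⟨20205⟩'s `stub_eternalLiouville`:
# TIGHTNESS IN THE ADMISSIBILITY CLAUSES — the bounded inviscid Liouville statement is FALSE the moment the
# two admissibility clauses of `IsEternal` (uniform shell action `∫‖W_n‖ ≤ M`; forward bound on `e^{2σ}‖W_n‖²`)
# are dropped, at EVERY scale ratio `1+ε₀` and on a member of EVERY class E₂(R), `R ≥ 2`.

MODEL lattice ODEs only (Tao 2016 §1.2, §4, §6.4); nothing in this file is a statement about the Navier–Stokes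
equations; no stub, crux, rung or summit is proved or refuted here.

THE WITNESS.  On the dyadic member `dyadicTable ∈ E₂(2)` (structure maps `Q = 0`, `A(x) = x₀² e₀`,
`B(y,x) = −x₀y₀ e₀`, tree `WakeRatchetDyadicFront.table{Q,A,B}_dyadicTable`) the CONSTANT family

  `W⋆_n(σ) = w⋆ e₀` for all `n ∈ ℤ`, `σ ∈ ℝ`,   `w⋆ = Λ/(Λ² − 1)`,   `Λ = bigLam ε₀ = (1+ε₀)^{5/2} > 1`,

solves the renormalised shell law of `IsEternal` exactly (`−w⋆ + Λ w⋆² − Λ⁻¹ w⋆² = 0`: a FIXED POINT of the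
renormalised dynamics), is uniformly bounded (`UniformBound`), and is forward (S_a)-surviving for EVERY
exponent `a` (`physWeight(a)^n · e^{2σ} w⋆² ≥ w⋆²` at late log-times) — while it violates BOTH admissibility
clauses: `σ ↦ ‖W⋆_n(σ)‖ = w⋆` is not integrable on `ℝ`, and `e^{2σ}‖W⋆_n(σ)‖²` is unbounded as `σ → ∞`.
In physical variables (`X_n(t) = Λ^{-n} e^{σ} W_n(σ)`, `t⋆ − t = e^{-σ}`) it is the positive two-sided
SEPARABLE blow-up `X_n(t) = Λ^{-n} w⋆/(t⋆ − t)` of the Katz–Pavlović chain `Ẋ_n = Λ^{n-1}X_{n-1}² − Λ^n X_n X_{n+1}`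
(`separable_physEnergy`): all shells blow up at the same instant, fed by the infinite energy reservoir at
`n → −∞` (the one-sided finite-energy chain has no positive separable blow-up — Barbato–Flandoli–Morandin,
arXiv:0811.1689 p. 3, whose blow-up branch has all components negative; the chain at every base `λ > 1`:
Waleffe 2004 §5, Kiselev–Zlatoš 2005 Thm. 1.1).  The docstrings of `IsDSSWave` / `IsEternal` (module
`RenormalisedCascadeWaves`) record in prose that this solution is excluded by the admissibility clauses; this
file makes the exclusion, and what dropping it costs, citable BY NAME.

CONSEQUENCE FOR PROVERS (why this is filed on ⟨20419⟩ / ⟨20205⟩).  Every inequality that follows from the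
shell law + `UniformBound` + membership in E₂(R) alone is satisfied by `W⋆`, which survives at every exponent.
Hence ANY proof of (ρ0) `NoSurvivingEternalBdd R 1`, of the `ν̂ = 0` half of K1ᵛ(1), or of ⟨20205⟩'s registered
`stub_eternalLiouville` must consume the action clause or the forward clause of `IsEternal` (the log-time
LOCALISATION of each shell's activity): energy/flux bookkeeping from the law and the type-I bound alone cannot
close them (`lawOnly_liouville_false`, `noSurvivingEternalBdd_false_without_admissibility`).

HONEST LABEL: an explicit-witness tightness lemma (S-sized); the separable solution is classical (BFM 2010,
Waleffe 2004); crux ⟨20419⟩, its children, ⟨20205⟩ and every NS statement remain OPEN.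
-/

noncomputable section

-- the summit and its single sub-problem share the name (CONVENTIONS §1)
set_option linter.dupNamespace false

namespace Summit.NavierStokesRegularity.NavierStokesRegularity.Theorems.NoSurvivingEternalViscBddOne.SeparableTightness

open Filter Topology Set MeasureTheory
open Literature.Analysis.FluidPDE Literature.Analysis.FluidPDE.TaoCascade
open Summit.NavierStokesRegularity.NavierStokesRegularity.Theorems.WakeRatchetDyadicFront
  (tableQ_dyadicTable tableA_dyadicTable tableB_dyadicTable)
open Summit.NavierStokesRegularity.NavierStokesRegularity.Theorems.WakeRatchetScalarFrontNoSlow (one_lt_bigLam')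

variable {ε₀ : ℝ}

/-! ## The separable amplitude `w⋆ = Λ/(Λ² − 1)` -/

/-- `Λ² − 1 > 0` for `ε₀ > 0` (`1 < Λ` is the tree's `WakeRatchetScalarFrontNoSlow.one_lt_bigLam'`).
[cite: Tao2016AveragedNS, §4 (4.1)] -/
theorem bigLam_sq_sub_one_pos (hε : 0 < ε₀) : 0 < bigLam ε₀ ^ 2 - 1 := by
  have h := one_lt_bigLam' hε
  nlinarith

/-- The separable amplitude `w⋆ = Λ/(Λ² − 1)` is positive.
[cite: Tao2016AveragedNS, §1.2 (dyadic chain) and §6.4 (renormalised variables); folklore (separable solutions of the chain, arXiv:0811.1689 p. 3)] -/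
theorem sepAmp_pos (hε : 0 < ε₀) : 0 < bigLam ε₀ / (bigLam ε₀ ^ 2 - 1) :=
  div_pos (lt_trans zero_lt_one (one_lt_bigLam' hε)) (bigLam_sq_sub_one_pos hε)

/-- The fixed-point identity of the renormalised dyadic law: `−w⋆ + Λ w⋆² − Λ⁻¹ w⋆² = 0` for `w⋆ = Λ/(Λ² − 1)`.
[cite: Tao2016AveragedNS, §1.2, §6.4; folklore (arXiv:0811.1689 p. 3)] -/
theorem sepAmp_fixedPoint (hε : 0 < ε₀) :
    -(bigLam ε₀ / (bigLam ε₀ ^ 2 - 1))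
      + bigLam ε₀ * (bigLam ε₀ / (bigLam ε₀ ^ 2 - 1)) ^ 2
      - (bigLam ε₀)⁻¹ * (bigLam ε₀ / (bigLam ε₀ ^ 2 - 1)) ^ 2 = 0 := by
  have hΛ : 0 < bigLam ε₀ := lt_trans zero_lt_one (one_lt_bigLam' hε)
  have hD : bigLam ε₀ ^ 2 - 1 ≠ 0 := (bigLam_sq_sub_one_pos hε).ne'
  field_simp
  ring

/-! ## The constant family `W⋆_n(σ) = w⋆ e₀`

All statements below are about a family `W` together with the hypothesis `hW : ∀ n σ, W n σ = w⋆ • e₀`;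
the family `fun _ _ => w⋆ • e₀` itself is plugged in only in the two closing theorems. -/

/-- `‖c • e₀‖ = |c|`. [elementary] -/
theorem norm_smul_single (c : ℝ) :
    ‖(c • EuclideanSpace.single (0 : Fin 4) (1 : ℝ) : Em 4)‖ = |c| := by
  rw [norm_smul, PiLp.norm_single, norm_one, mul_one, Real.norm_eq_abs]

/-- **The renormalised shell law holds for the constant family.**  For every `n ∈ ℤ` and `σ ∈ ℝ`,
`W⋆_n(σ) = w⋆ e₀` satisfies the law of `IsEternal ε₀ dyadicTable` (damping `1`, feed `Λ`, drain `Λ⁻¹`):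
the right-hand side `−W⋆ + Q(W⋆) + Λ A(W⋆) + Λ⁻¹ B(W⋆, W⋆) = (−w⋆ + Λw⋆² − Λ⁻¹w⋆²) e₀` vanishes.
[cite: Tao2016AveragedNS, §4 Lemma 4.1 (iii) (4.8) in the self-similar variables of §6.4, §1.2 (dyadic member); folklore (separable solutions, arXiv:0811.1689 p. 3)] -/
theorem separable_law (hε : 0 < ε₀) {W : ℤ → ℝ → Em 4}
    (hW : ∀ (n : ℤ) (σ : ℝ),
      W n σ = (bigLam ε₀ / (bigLam ε₀ ^ 2 - 1)) • EuclideanSpace.single (0 : Fin 4) (1 : ℝ))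
    (n : ℤ) (σ : ℝ) :
    HasDerivAt (W n)
      (-((1 : ℝ) • W n σ) + tableQ dyadicTable (W n σ) + bigLam ε₀ • tableA dyadicTable (W (n - 1) σ)
        + (bigLam ε₀)⁻¹ • tableB dyadicTable (W (n + 1) σ) (W n σ)) σ := by
  set w : ℝ := bigLam ε₀ / (bigLam ε₀ ^ 2 - 1) with hw
  have hfix := sepAmp_fixedPoint hε
  rw [← hw] at hfix
  have hfun : W n = fun _ : ℝ => (w • EuclideanSpace.single (0 : Fin 4) (1 : ℝ) : Em 4) :=
    funext (hW n)
  rw [hfun, hW (n - 1) σ, hW (n + 1) σ]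
  refine (hasDerivAt_const σ _).congr_deriv ?_
  ext i
  simp only [tableQ_dyadicTable, tableA_dyadicTable, tableB_dyadicTable, PiLp.add_apply,
    PiLp.smul_apply, PiLp.neg_apply, PiLp.zero_apply, PiLp.single_apply, smul_eq_mul,
    mul_ite, mul_one, mul_zero]
  split_ifs with hi
  · linear_combination (-1 : ℝ) * hfix
  · ring

/-- The constant family is uniformly bounded (`‖W⋆_n(σ)‖ = w⋆`).
[cite: Tao2016AveragedNS, §4 Thm. 4.2 (statement shape), §6.4; cell vocabulary (`UniformBound`)] -/
theorem separable_uniformBound (ε₀ : ℝ) {W : ℤ → ℝ → Em 4}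
    (hW : ∀ (n : ℤ) (σ : ℝ),
      W n σ = (bigLam ε₀ / (bigLam ε₀ ^ 2 - 1)) • EuclideanSpace.single (0 : Fin 4) (1 : ℝ)) :
    UniformBound W :=
  ⟨|bigLam ε₀ / (bigLam ε₀ ^ 2 - 1)|, fun k σ => by rw [hW k σ, norm_smul_single]⟩

/-- The physical shell energy of the constant family: `E_n(σ) = Λ^{-2n} e^{2σ} w⋆²`, i.e.
`X_n(t) = Λ^{-n} w⋆/(t⋆ − t)` — the two-sided separable (simultaneous) blow-up of the chain.
[cite: Tao2016AveragedNS, §4 Lemma 4.1 (4.10), §6.4; folklore (arXiv:0811.1689 p. 3)] -/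
theorem separable_physEnergy (ε₀ : ℝ) {W : ℤ → ℝ → Em 4}
    (hW : ∀ (n : ℤ) (σ : ℝ),
      W n σ = (bigLam ε₀ / (bigLam ε₀ ^ 2 - 1)) • EuclideanSpace.single (0 : Fin 4) (1 : ℝ))
    (n : ℤ) (σ : ℝ) :
    physEnergy ε₀ W n σ
      = (bigLam ε₀ ^ n)⁻¹ ^ 2 * Real.exp (2 * σ) * (bigLam ε₀ / (bigLam ε₀ ^ 2 - 1)) ^ 2 := by
  unfold physEnergy
  rw [hW n σ, norm_smul_single, sq_abs]
  ring

/-- Late log-times beat any geometric weight: for `p > 0` and `N` there is `σ ≥ N` with `1 ≤ p · e^{2σ}`.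
[elementary] -/
theorem exists_late_logTime {p : ℝ} (hp : 0 < p) (N : ℝ) :
    ∃ σ : ℝ, N ≤ σ ∧ 1 ≤ p * Real.exp (2 * σ) := by
  obtain ⟨x₀, hx₀⟩ := Filter.eventually_atTop.1 (Real.tendsto_exp_atTop.eventually_ge_atTop p⁻¹)
  refine ⟨max N (max x₀ 0), le_max_left _ _, ?_⟩
  set σ : ℝ := max N (max x₀ 0) with hσ
  have hσ0 : 0 ≤ σ := le_trans (le_max_right _ _) (le_max_right _ _)
  have hσx : x₀ ≤ 2 * σ := by
    have : x₀ ≤ σ := le_trans (le_max_left _ _) (le_max_right _ _)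
    linarith
  have h1 : p⁻¹ ≤ Real.exp (2 * σ) := hx₀ _ hσx
  have h2 : p * p⁻¹ ≤ p * Real.exp (2 * σ) := mul_le_mul_of_nonneg_left h1 hp.le
  rwa [mul_inv_cancel₀ hp.ne'] at h2

/-- **The constant family is forward (S_a)-surviving for EVERY exponent `a`**: at shell `n = N` and a late
enough log-time `σ ≥ N`, `physWeight(a)^N · e^{2σ} · w⋆² ≥ w⋆² > 0`.
[cite: Tao2016AveragedNS, §4 (the viscous equation before Thm. 4.2), §6.4; cell vocabulary (`EternalSurvivingFwd`)] -/
theorem separable_survivingFwd (hε : 0 < ε₀) (a : ℝ) {W : ℤ → ℝ → Em 4}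
    (hW : ∀ (n : ℤ) (σ : ℝ),
      W n σ = (bigLam ε₀ / (bigLam ε₀ ^ 2 - 1)) • EuclideanSpace.single (0 : Fin 4) (1 : ℝ)) :
    EternalSurvivingFwd a ε₀ W := by
  set w : ℝ := bigLam ε₀ / (bigLam ε₀ ^ 2 - 1) with hw
  have hwpos : 0 < w := sepAmp_pos hε
  have hpw : 0 < physWeight a ε₀ := by
    unfold physWeight
    exact div_pos (Real.rpow_pos_of_pos (by linarith) _) (pow_pos (by linarith) _)
  refine ⟨w ^ 2, pow_pos hwpos 2, fun N => ⟨N, le_rfl, ?_⟩⟩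
  obtain ⟨σ, hσN, hσ⟩ := exists_late_logTime (pow_pos hpw N) (N : ℝ)
  refine ⟨σ, hσN, ?_⟩
  have hnorm : ‖W (N : ℤ) σ‖ = w := by rw [hW, norm_smul_single, abs_of_pos hwpos]
  rw [hnorm]
  have h := mul_le_mul_of_nonneg_right hσ (sq_nonneg w)
  calc w ^ 2 = 1 * w ^ 2 := (one_mul _).symm
    _ ≤ physWeight a ε₀ ^ N * Real.exp (2 * σ) * w ^ 2 := h
    _ = physWeight a ε₀ ^ N * (Real.exp (2 * σ) * w ^ 2) := by ring

/-- **The action clause fails**: `σ ↦ ‖W⋆_n(σ)‖ = w⋆ ≠ 0` is not Lebesgue-integrable on `ℝ`.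
[cite: Tao2016AveragedNS, §6.4; cell vocabulary (`IsEternal.action`)] -/
theorem separable_not_integrable (hε : 0 < ε₀) {W : ℤ → ℝ → Em 4}
    (hW : ∀ (n : ℤ) (σ : ℝ),
      W n σ = (bigLam ε₀ / (bigLam ε₀ ^ 2 - 1)) • EuclideanSpace.single (0 : Fin 4) (1 : ℝ))
    (n : ℤ) : ¬ Integrable (fun σ : ℝ => ‖W n σ‖) := by
  have hwpos : 0 < bigLam ε₀ / (bigLam ε₀ ^ 2 - 1) := sepAmp_pos hε
  have hfun : (fun σ : ℝ => ‖W n σ‖) = fun _ : ℝ => bigLam ε₀ / (bigLam ε₀ ^ 2 - 1) := by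
    funext σ
    rw [hW n σ, norm_smul_single, abs_of_pos hwpos]
  rw [hfun]
  intro h
  have hfin : IsFiniteMeasure (volume : Measure ℝ) :=
    (integrable_const_iff_isFiniteMeasure hwpos.ne').1 h
  have hlt := measure_lt_top (volume : Measure ℝ) (univ : Set ℝ)
  rw [Real.volume_univ] at hlt
  exact lt_irrefl _ hlt

/-- **The forward clause fails**: `e^{2σ}‖W⋆_n(σ)‖² = e^{2σ} w⋆²` is unbounded on every right half-line.
[cite: Tao2016AveragedNS, §6.4; cell vocabulary (`IsEternal.bdd`)] -/
theorem separable_not_bdd (hε : 0 < ε₀) {W : ℤ → ℝ → Em 4}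
    (hW : ∀ (n : ℤ) (σ : ℝ),
      W n σ = (bigLam ε₀ / (bigLam ε₀ ^ 2 - 1)) • EuclideanSpace.single (0 : Fin 4) (1 : ℝ))
    (n : ℤ) : ¬ ∃ σ₀ P : ℝ, ∀ σ : ℝ, σ₀ ≤ σ → Real.exp (2 * σ) * ‖W n σ‖ ^ 2 ≤ P := by
  set w : ℝ := bigLam ε₀ / (bigLam ε₀ ^ 2 - 1) with hw
  have hwpos : 0 < w := sepAmp_pos hε
  rintro ⟨σ₀, P, hP⟩
  have hP0 : 0 ≤ P := by
    have h := hP σ₀ le_rfl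
    exact le_trans (by positivity) h
  -- a late log-time with `(P + 1)/w² ≤ e^{2σ}`
  have hq : 0 < w ^ 2 / (P + 1) := div_pos (pow_pos hwpos 2) (by linarith)
  obtain ⟨σ, hσ₀, hσ⟩ := exists_late_logTime hq σ₀
  have hnorm : ‖W n σ‖ = w := by rw [hW, norm_smul_single, abs_of_pos hwpos]
  have hle := hP σ hσ₀
  rw [hnorm] at hle
  -- `1 ≤ (w²/(P+1)) e^{2σ}` gives `P + 1 ≤ e^{2σ} w²`
  have h1 : P + 1 ≤ Real.exp (2 * σ) * w ^ 2 := by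
    have h := mul_le_mul_of_nonneg_left hσ (by linarith : (0 : ℝ) ≤ P + 1)
    rw [mul_one] at h
    calc P + 1 ≤ (P + 1) * (w ^ 2 / (P + 1) * Real.exp (2 * σ)) := h
      _ = Real.exp (2 * σ) * w ^ 2 := by field_simp
  linarith

/-- Hence the constant family is NOT an admissible eternal solution (inviscid) …
[cite: Tao2016AveragedNS, §4 Lemma 4.1 (iii) (4.8), §6.4; cell vocabulary (`IsEternal`)] -/
theorem separable_not_isEternal (hε : 0 < ε₀) {W : ℤ → ℝ → Em 4}
    (hW : ∀ (n : ℤ) (σ : ℝ),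
      W n σ = (bigLam ε₀ / (bigLam ε₀ ^ 2 - 1)) • EuclideanSpace.single (0 : Fin 4) (1 : ℝ)) :
    ¬ IsEternal ε₀ dyadicTable W := by
  intro h
  obtain ⟨M, hM⟩ := h.action
  exact separable_not_integrable hε hW 0 (hM 0).1

/-- … nor an admissible eternal solution with ANY covariant viscosity `ν̂` (the action clause is the same).
[cite: Tao2016AveragedNS, §4, the viscous equation before Thm. 4.2, §6.4; cell vocabulary (`IsEternalVisc`)] -/
theorem separable_not_isEternalVisc (hε : 0 < ε₀) (νh : ℝ) {W : ℤ → ℝ → Em 4}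
    (hW : ∀ (n : ℤ) (σ : ℝ),
      W n σ = (bigLam ε₀ / (bigLam ε₀ ^ 2 - 1)) • EuclideanSpace.single (0 : Fin 4) (1 : ℝ)) :
    ¬ IsEternalVisc ε₀ νh dyadicTable W := by
  intro h
  obtain ⟨M, hM⟩ := h.action
  exact separable_not_integrable hε hW 0 (hM 0).1

/-! ## The tightness statements -/

/-- **LAW-ONLY LIOUVILLE IS FALSE on the dyadic member, at every `ε₀ > 0` and every exponent `a`.**
There is a family `W` solving the renormalised shell law of `dyadicTable` at every shell and log-time,
uniformly bounded, and forward (S_a)-surviving — namely the constant family `W⋆ ≡ w⋆ e₀` — which is not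
`IsEternal` (both admissibility clauses fail).
[cite: Tao2016AveragedNS, §4 Lemma 4.1 (iii) (4.8), Thm. 4.2 (statement shape), §6.4, §1.2; folklore (separable solutions of the chain, arXiv:0811.1689 p. 3)] -/
theorem lawOnly_liouville_false (hε : 0 < ε₀) (a : ℝ) :
    ∃ W : ℤ → ℝ → Em 4,
      (∀ (n : ℤ) (σ : ℝ), HasDerivAt (W n)
        (-((1 : ℝ) • W n σ) + tableQ dyadicTable (W n σ) + bigLam ε₀ • tableA dyadicTable (W (n - 1) σ)
          + (bigLam ε₀)⁻¹ • tableB dyadicTable (W (n + 1) σ) (W n σ)) σ)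
      ∧ UniformBound W ∧ EternalSurvivingFwd a ε₀ W
      ∧ (∀ n : ℤ, ¬ Integrable (fun σ : ℝ => ‖W n σ‖))
      ∧ (∀ n : ℤ, ¬ ∃ σ₀ P : ℝ, ∀ σ : ℝ, σ₀ ≤ σ → Real.exp (2 * σ) * ‖W n σ‖ ^ 2 ≤ P)
      ∧ ¬ IsEternal ε₀ dyadicTable W := by
  refine ⟨fun _ _ => (bigLam ε₀ / (bigLam ε₀ ^ 2 - 1)) • EuclideanSpace.single (0 : Fin 4) (1 : ℝ),
    fun n σ => separable_law hε (fun _ _ => rfl) n σ, separable_uniformBound ε₀ (fun _ _ => rfl),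
    separable_survivingFwd hε a (fun _ _ => rfl), fun n => separable_not_integrable hε (fun _ _ => rfl) n,
    fun n => separable_not_bdd hε (fun _ _ => rfl) n, separable_not_isEternal hε (fun _ _ => rfl)⟩

/-- **`NoSurvivingEternalBdd` WITHOUT ADMISSIBILITY IS FALSE for every spread `R ≥ 2` and every exponent `a`.**
The predicate obtained from `TaoCascade.NoSurvivingEternalBdd R a` by replacing `IsEternal ε₀ α W` with its
`law` clause alone fails: for every threshold `εs > 0`, at `ε₀ = εs` the table `dyadicTable ∈ E₂(R)` and the
constant family `W⋆` are a counterexample.  So the action / forward clauses of `IsEternal` are load-bearing in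
(ρ0) `stub_noSurvivingEternalBddOne`, in the `ν̂ = 0` half of the crux K1ᵛ(1), and in ⟨20205⟩'s
`stub_eternalLiouville` (which has no `UniformBound` hypothesis at all).
[cite: Tao2016AveragedNS, §4 Thm. 4.2 (statement shape), Lemma 4.1 (4.8), §6.4, §1.2; folklore (separable solutions of the chain, arXiv:0811.1689 p. 3)] -/
theorem noSurvivingEternalBdd_false_without_admissibility {R : ℝ} (hR : 2 ≤ R) (a : ℝ) :
    ¬ ∃ εs : ℝ, 0 < εs ∧ ∀ ε₀ : ℝ, 0 < ε₀ → ε₀ ≤ εs →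
      ∀ α : Fin 4 → Fin 4 → Fin 4 → ℤ × ℤ × ℤ → ℝ, InTableClass R α →
        ∀ W : ℤ → ℝ → Em 4,
          (∀ (n : ℤ) (σ : ℝ), HasDerivAt (W n)
            (-((1 : ℝ) • W n σ) + tableQ α (W n σ) + bigLam ε₀ • tableA α (W (n - 1) σ)
              + (bigLam ε₀)⁻¹ • tableB α (W (n + 1) σ) (W n σ)) σ) →
          UniformBound W → ¬ EternalSurvivingFwd a ε₀ W := by
  rintro ⟨εs, hεs, H⟩
  obtain ⟨W, hlaw, hUB, hS, -, -, -⟩ := lawOnly_liouville_false hεs a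
  exact H εs hεs le_rfl dyadicTable (inTableClass_dyadicTable hR) W hlaw hUB hS

/-- The same, read against the registered stub of ⟨20205⟩ (`stub_eternalLiouville` = `NoSurvivingEternalFwd R 1`
shape, no boundedness hypothesis): its law-only variant is false for every `R ≥ 2`.
[cite: Tao2016AveragedNS, §4 Thm. 4.2 (statement shape), Lemma 4.1 (4.8), §6.4, §1.2] -/
theorem noSurvivingEternalFwd_false_without_admissibility {R : ℝ} (hR : 2 ≤ R) (a : ℝ) :
    ¬ ∃ εs : ℝ, 0 < εs ∧ ∀ ε₀ : ℝ, 0 < ε₀ → ε₀ ≤ εs →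
      ∀ α : Fin 4 → Fin 4 → Fin 4 → ℤ × ℤ × ℤ → ℝ, InTableClass R α →
        ∀ W : ℤ → ℝ → Em 4,
          (∀ (n : ℤ) (σ : ℝ), HasDerivAt (W n)
            (-((1 : ℝ) • W n σ) + tableQ α (W n σ) + bigLam ε₀ • tableA α (W (n - 1) σ)
              + (bigLam ε₀)⁻¹ • tableB α (W (n + 1) σ) (W n σ)) σ) →
          ¬ EternalSurvivingFwd a ε₀ W := by
  rintro ⟨εs, hεs, H⟩
  obtain ⟨W, hlaw, -, hS, -, -, -⟩ := lawOnly_liouville_false hεs a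
  exact H εs hεs le_rfl dyadicTable (inTableClass_dyadicTable hR) W hlaw hS

/-- Conversely, the typed predicates are untouched by the witness: (ρ0) `NoSurvivingEternalBdd R a` quantifies
over `IsEternal` solutions only, and the constant family is not one — recorded so that no reader mistakes the
tightness lemma for a refutation.
[cite: Tao2016AveragedNS, §4 Thm. 4.2 (statement shape), §6.4; cell vocabulary] -/
theorem separable_not_in_scope (hε : 0 < ε₀) (νh : ℝ) :
    ¬ IsEternalVisc ε₀ νh dyadicTable
        (fun (_ : ℤ) (_ : ℝ) =>
          ((bigLam ε₀ / (bigLam ε₀ ^ 2 - 1)) • EuclideanSpace.single (0 : Fin 4) (1 : ℝ) : Em 4))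
      ∧ ¬ IsEternal ε₀ dyadicTable
        (fun (_ : ℤ) (_ : ℝ) =>
          ((bigLam ε₀ / (bigLam ε₀ ^ 2 - 1)) • EuclideanSpace.single (0 : Fin 4) (1 : ℝ) : Em 4)) :=
  ⟨separable_not_isEternalVisc hε νh (fun _ _ => rfl), separable_not_isEternal hε (fun _ _ => rfl)⟩

end Summit.NavierStokesRegularity.NavierStokesRegularity.Theorems.NoSurvivingEternalViscBddOne.SeparableTightness

end
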